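import Literature.Probability.Percolation.SequentialProbing
import HarnessLib

/-!
# Chernoff bounds for the number of hits among the designated probes of a sequential exploration

Topic `Literature/Probability/Percolation`, companion of `SequentialProbing.lean` (the explorer
`Explorer V`, its histories `Explorer.hist`, freshness `Explorer.Fresh`, the product formula and the
conditional steps). An exploration of a percolation configuration that examines fresh edge sets one
after the other gives rise to two martingale estimates which are used constantly in "dynamic"
arguments (Kozma–Nachmias 2011, §4.4, Lemmas 4.5 and 4.6, where they are obtained from the
Azuma–Hoeffding inequality for the two exploration martingales `β_i`, `γ_i`; Grimmett 1999, §7.2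
Lemma (7.24)): if every designated probe *hits* (its observation satisfies a prescribed,
history-dependent predicate) with conditional probability at most `ρ`, then many hits among few
designated probes are exponentially unlikely; if every designated probe hits with conditional
probability at least `μ`, then few hits among many designated probes are exponentially unlikely.
We PROVE both in the sharper Chernoff (exponential-moment) form, with no geometry:

The scores are those of `SequentialProbing.lean`: the *hits* counted here are the designated
failures `ProbeHistory.nfail succ desig h` (the number of designated probes of `h` whose
observation `o` violates `succ h' o`, `h'` the history before the probe; for Kozma–Nachmias' bad
boxes take `succ h o := ¬ bad`, for their boundary hits take `succ h o := ¬ hit`), and the only new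
count is

* `ProbeHistory.ndesig desig h` — the number of designated probes made along the history `h`
  (`nfail ≤ ndesig ≤ length`, `ProbeHistory.nfail_le_ndesig`).

Proved here:

* `Explorer.measureReal_step_linear_le` — the **linear conditional step**: if after every
  history satisfying `Φ` the next probe satisfies `P(ψ) + φ·P(¬ψ) ≤ c`, then
  `P(A₀ ∩ {Φ, next probe in ψ}) + φ·P(A₀ ∩ {Φ, next probe in ¬ψ}) ≤ c·P(A₀ ∩ {Φ, a probe is made})`
  (the product formula summed over the countably many histories; the case `φ = 0` is
  `measureReal_inter_setOf_step_le`).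
* `Explorer.sum_weight_mul_measureReal_levelSet₂_le` — **the exponential supermartingale**: with the
  joint level sets `levelSet₂ n v w = {nfail = v, ndesig = w at time n}`,
  `Σ_{v,w} φ^v c^{-w} P(A₀ ∩ levelSet₂ n v w) ≤ P(A₀)` under the step hypothesis
  `P(succ) + φ·P(¬succ) ≤ c` for designated probes.
* `Explorer.measureReal_inter_le_of_failProb_le` — **upper tail** (Kozma–Nachmias 2011, Lemma 4.6
  in abstract form): if every designated probe fails with probability `≤ ρ`, then for `t ≥ 0`,
  `P(A₀ ∩ {a ≤ nfail, ndesig ≤ i}) ≤ e^{-ta} (1 + ρ(e^t - 1))^i P(A₀)`.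
* `Explorer.measureReal_inter_le_of_le_failProb` — **lower tail** (Kozma–Nachmias 2011, Lemma 4.5
  in abstract form): if every designated probe fails with probability `≥ μ₀`, then for `t ≥ 0`,
  `P(A₀ ∩ {nfail ≤ a, i ≤ ndesig}) ≤ e^{ta} (1 - μ₀(1 - e^{-t}))^i P(A₀)`.

(The accepted Peierls input `measureReal_inter_le_nfail_le` bounds `{k ≤ nfail, no designated
success}`; the two tails here carry the number of designated probes instead.) All statements are
about `bondPercolation G p` on a countable vertex type, for an explorer fresh with respect to `U₀`
and an initial event `A₀` determined by `U₀`, exactly as in `SequentialProbing.lean`.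

## References

* G. Kozma, A. Nachmias, *Arm exponents in high dimensional percolation*, J. Amer. Math. Soc. 24
  (2011) 375–409, §4.4 (the exploration martingales; Lemmas 4.5, 4.6).
* G. Grimmett, *Percolation*, 2nd ed., Springer 1999, §7.2 Lemma (7.24), §7.3 p. 176.
* W. Hoeffding, J. Amer. Statist. Assoc. 58 (1963) 13–30 (exponential-moment method).
-/

noncomputable section

namespace Literature.Probability.Percolation

open MeasureTheory ProbabilityTheory Finset
open scoped ENNReal Classical

variable {V : Type*}

namespace ProbeHistory

section Counts

variable (succ : ProbeHistory V → Finset (Sym2 V) → Prop) (desig : ProbeHistory V → Prop)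

/-- The number of *designated* probes made along a history (`desig h`: the probe made after the
history `h` is designated). [cite: KozmaNachmias2011, §4.4 (the stopping time `τ`: the number of explored boxes)] -/
def ndesig : ProbeHistory V → ℕ
  | [] => 0
  | none :: h => ndesig h
  | some _ :: h => ndesig h + (if desig h then 1 else 0)

variable {succ desig}

/-- `ndesig` of the empty history. [folklore] -/
@[simp] theorem ndesig_nil : ndesig desig ([] : ProbeHistory V) = 0 := rfl
/-- `ndesig` is unchanged by a `none` step. [folklore] -/
@[simp] theorem ndesig_cons_none (h : ProbeHistory V) : ndesig desig (none :: h) = ndesig desig h := rfl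
/-- `ndesig` after a probe. [folklore] -/
theorem ndesig_cons_some (r : ProbeRecord V) (h : ProbeHistory V) :
    ndesig desig (some r :: h) = ndesig desig h + (if desig h then 1 else 0) := rfl

/-- At most one designated probe per step. [folklore] -/
theorem ndesig_le_length (h : ProbeHistory V) : ndesig desig h ≤ h.length := by
  induction h with
  | nil => simp
  | cons s h ih =>
    cases s with
    | none => simp only [ndesig_cons_none, List.length_cons]; omega
    | some r =>
      rw [ndesig_cons_some, List.length_cons]
      split_ifs <;> omega

/-- Designated failures are designated probes. [folklore] -/
theorem nfail_le_ndesig (h : ProbeHistory V) : nfail succ desig h ≤ ndesig desig h := by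
  induction h with
  | nil => simp
  | cons s h ih =>
    cases s with
    | none => simpa using ih
    | some r =>
      rw [nfail_cons_some, ndesig_cons_some]
      by_cases hd : desig h
      · by_cases hp : succ h r.2
        · rw [if_neg (fun h' => h'.2 hp), if_pos hd]; omega
        · rw [if_pos ⟨hd, hp⟩, if_pos hd]; omega
      · rw [if_neg (fun h' => hd h'.1), if_neg hd]; omega

end Counts

end ProbeHistory

open ProbeHistory

namespace Explorer

variable (E : Explorer V) [Countable V] (G : SimpleGraph V) (p : unitInterval)

/-! ## The linear conditional step -/

/-- **Linear conditional step.** If after every history satisfying `Φ` whose next probe has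
support `D` we have `P(ψ(ω ∩ D)) + φ·P(¬ψ(ω ∩ D)) ≤ c`, then
`P(A₀ ∩ {Φ(hist n), probe made, ψ}) + φ·P(A₀ ∩ {Φ(hist n), probe made, ¬ψ}) ≤
c·P(A₀ ∩ {Φ(hist n), a probe is made})` — the product formula
(`measure_inter_hist_inter_obs`) summed over the histories. [cite: KozmaNachmias2011, §4.4 (proof of Lemma 4.6: "by locality, P(q_k is bad | F_{k-1}) = P(x is s-locally-bad)")] -/
theorem measureReal_step_linear_le {U₀ : Set (Sym2 V)} (hE : E.Fresh U₀) {A₀ : Set (BondConfig V)}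
    (hA : DeterminedBy A₀ U₀) (hAm : MeasurableSet A₀) (n : ℕ) (Φ : ProbeHistory V → Prop)
    (ψ : ProbeHistory V → Finset (Sym2 V) → Prop) {φ c : ℝ} (hφ : 0 ≤ φ) (hc : 0 ≤ c)
    (hstep : ∀ h D, E.next h = some D → Φ h →
      (bondPercolation G p).real {ω | ψ h (obs ω D)} +
        φ * (bondPercolation G p).real {ω | ¬ψ h (obs ω D)} ≤ c) :
    (bondPercolation G p).real
        (A₀ ∩ {ω | Φ (E.hist n ω) ∧ ∃ D, E.next (E.hist n ω) = some D ∧ ψ (E.hist n ω) (obs ω D)}) +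
      φ * (bondPercolation G p).real
        (A₀ ∩ {ω | Φ (E.hist n ω) ∧ ∃ D, E.next (E.hist n ω) = some D ∧ ¬ψ (E.hist n ω) (obs ω D)}) ≤
      c * (bondPercolation G p).real (A₀ ∩ {ω | Φ (E.hist n ω) ∧ E.next (E.hist n ω) ≠ none}) := by
  classical
  set μ := bondPercolation G p with hμ
  -- the pieces over the histories, for an arbitrary outcome predicate
  set X : (ProbeHistory V → Finset (Sym2 V) → Prop) → ProbeHistory V → Set (BondConfig V) := fun ψ' h =>
    (A₀ ∩ {ω | E.hist n ω = h}) ∩ {ω | Φ h ∧ ∃ D, E.next h = some D ∧ ψ' h (obs ω D)} with hX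
  set Y : ProbeHistory V → Set (BondConfig V) := fun h =>
    (A₀ ∩ {ω | E.hist n ω = h}) ∩ {_ω | Φ h ∧ E.next h ≠ none} with hY
  have hXeq : ∀ ψ' : ProbeHistory V → Finset (Sym2 V) → Prop,
      A₀ ∩ {ω | Φ (E.hist n ω) ∧ ∃ D, E.next (E.hist n ω) = some D ∧ ψ' (E.hist n ω) (obs ω D)} =
        ⋃ h, X ψ' h := by
    intro ψ'
    ext ω
    simp only [hX, Set.mem_inter_iff, Set.mem_setOf_eq, Set.mem_iUnion]
    exact ⟨fun ⟨hA, hΦ⟩ => ⟨_, ⟨hA, rfl⟩, hΦ⟩, fun ⟨h, ⟨hA, hh⟩, hΦ⟩ => ⟨hA, hh ▸ hΦ⟩⟩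
  have hYeq : A₀ ∩ {ω | Φ (E.hist n ω) ∧ E.next (E.hist n ω) ≠ none} = ⋃ h, Y h := by
    ext ω
    simp only [hY, Set.mem_inter_iff, Set.mem_setOf_eq, Set.mem_iUnion]
    exact ⟨fun ⟨hA, hΦ⟩ => ⟨_, ⟨hA, rfl⟩, hΦ⟩, fun ⟨h, ⟨hA, hh⟩, hΦ⟩ => ⟨hA, hh ▸ hΦ⟩⟩
  have hdisj : ∀ Z : ProbeHistory V → Set (BondConfig V),
      Pairwise (Function.onFun Disjoint fun h => (A₀ ∩ {ω | E.hist n ω = h}) ∩ Z h) := by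
    intro Z h h' hne
    exact Set.disjoint_left.2 fun ω hω hω' => hne (hω.1.2.symm.trans hω'.1.2)
  -- measurability of the pieces
  have hXm : ∀ (ψ' : ProbeHistory V → Finset (Sym2 V) → Prop) (h : ProbeHistory V), MeasurableSet (X ψ' h) := by
    intro ψ' h
    refine (hAm.inter (E.measurableSet_hist_eq n h)).inter ?_
    cases hD : E.next h with
    | none =>
      have : {ω : BondConfig V | Φ h ∧ ∃ D, (none : Option (Finset (Sym2 V))) = some D ∧ ψ' h (obs ω D)} = ∅ := by
        ext ω; simp
      rw [this]; exact MeasurableSet.empty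
    | some D =>
      have : {ω : BondConfig V | Φ h ∧ ∃ D', some D = some D' ∧ ψ' h (obs ω D')} = {ω | Φ h ∧ ψ' h (obs ω D)} := by
        ext ω; simp
      rw [this]
      exact measurableSet_setOf_obs D fun o => Φ h ∧ ψ' h o
  have hYm : ∀ h, MeasurableSet (Y h) := fun h =>
    (hAm.inter (E.measurableSet_hist_eq n h)).inter (MeasurableSet.const _)
  -- termwise inequality in `ℝ≥0∞`
  have hterm : ∀ h, μ (X ψ h) + ENNReal.ofReal φ * μ (X (fun h o => ¬ψ h o) h) ≤ ENNReal.ofReal c * μ (Y h) := by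
    intro h
    rcases Option.eq_none_or_eq_some (E.next h) with hD | ⟨D, hD⟩
    · have h1 : X ψ h = ∅ := by ext ω; simp [hX, hD]
      have h2 : X (fun h o => ¬ψ h o) h = ∅ := by ext ω; simp [hX, hD]
      rw [h1, h2, measure_empty, mul_zero, zero_add]
      exact zero_le
    · by_cases hΦ : Φ h
      · have hX1 : X ψ h = (A₀ ∩ {ω | E.hist n ω = h}) ∩ {ω | ψ h (obs ω D)} := by
          ext ω; simp [hX, hD, hΦ]
        have hX2 : X (fun h o => ¬ψ h o) h = (A₀ ∩ {ω | E.hist n ω = h}) ∩ {ω | ¬ψ h (obs ω D)} := by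
          ext ω; simp [hX, hD, hΦ]
        have hYh : Y h = A₀ ∩ {ω | E.hist n ω = h} := by
          ext ω; simp [hY, hD, hΦ]
        rw [hX1, hX2, hYh, E.measure_inter_hist_inter_obs G p hE hA hAm n hD (ψ h),
          E.measure_inter_hist_inter_obs G p hE hA hAm n hD (fun o => ¬ψ h o)]
        have key : μ {ω | ψ h (obs ω D)} + ENNReal.ofReal φ * μ {ω | ¬ψ h (obs ω D)} ≤ ENNReal.ofReal c := by
          have h1 : μ {ω | ψ h (obs ω D)} = ENNReal.ofReal (μ.real {ω | ψ h (obs ω D)}) :=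
            (ENNReal.ofReal_toReal (measure_ne_top _ _)).symm
          have h2 : μ {ω | ¬ψ h (obs ω D)} = ENNReal.ofReal (μ.real {ω | ¬ψ h (obs ω D)}) :=
            (ENNReal.ofReal_toReal (measure_ne_top _ _)).symm
          rw [h1, h2, ← ENNReal.ofReal_mul hφ, ← ENNReal.ofReal_add measureReal_nonneg
            (mul_nonneg hφ measureReal_nonneg)]
          exact ENNReal.ofReal_le_ofReal (hstep h D hD hΦ)
        calc μ (A₀ ∩ {ω | E.hist n ω = h}) * μ {ω | ψ h (obs ω D)} +
              ENNReal.ofReal φ * (μ (A₀ ∩ {ω | E.hist n ω = h}) * μ {ω | ¬ψ h (obs ω D)})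
            = μ (A₀ ∩ {ω | E.hist n ω = h}) *
                (μ {ω | ψ h (obs ω D)} + ENNReal.ofReal φ * μ {ω | ¬ψ h (obs ω D)}) := by ring
          _ ≤ μ (A₀ ∩ {ω | E.hist n ω = h}) * ENNReal.ofReal c := mul_le_mul_right key _
          _ = ENNReal.ofReal c * μ (A₀ ∩ {ω | E.hist n ω = h}) := mul_comm _ _
      · have h1 : X ψ h = ∅ := by ext ω; simp [hX, hΦ]
        have h2 : X (fun h o => ¬ψ h o) h = ∅ := by ext ω; simp [hX, hΦ]
        rw [h1, h2, measure_empty, mul_zero, zero_add]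
        exact zero_le
  -- sum over the histories
  have hsum : μ (⋃ h, X ψ h) + ENNReal.ofReal φ * μ (⋃ h, X (fun h o => ¬ψ h o) h) ≤
      ENNReal.ofReal c * μ (⋃ h, Y h) := by
    rw [measure_iUnion (hdisj _) (hXm ψ), measure_iUnion (hdisj _) (hXm (fun h o => ¬ψ h o)),
      measure_iUnion (hdisj _) hYm,
      ← ENNReal.tsum_mul_left, ← ENNReal.tsum_add, ← ENNReal.tsum_mul_left]
    exact ENNReal.tsum_le_tsum hterm
  -- back to real numbers
  rw [hXeq ψ, hXeq (fun h o => ¬ψ h o), hYeq]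
  simp only [measureReal_def]
  have hfin1 : μ (⋃ h, X ψ h) ≠ ∞ := measure_ne_top _ _
  have hfin2 : μ (⋃ h, X (fun h o => ¬ψ h o) h) ≠ ∞ := measure_ne_top _ _
  have hfin3 : μ (⋃ h, Y h) ≠ ∞ := measure_ne_top _ _
  have hlhs : (μ (⋃ h, X ψ h)).toReal + φ * (μ (⋃ h, X (fun h o => ¬ψ h o) h)).toReal =
      (μ (⋃ h, X ψ h) + ENNReal.ofReal φ * μ (⋃ h, X (fun h o => ¬ψ h o) h)).toReal := by
    rw [ENNReal.toReal_add hfin1 (ENNReal.mul_ne_top ENNReal.ofReal_ne_top hfin2), ENNReal.toReal_mul,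
      ENNReal.toReal_ofReal hφ]
  rw [hlhs]
  calc (μ (⋃ h, X ψ h) + ENNReal.ofReal φ * μ (⋃ h, X (fun h o => ¬ψ h o) h)).toReal
      ≤ (ENNReal.ofReal c * μ (⋃ h, Y h)).toReal :=
        ENNReal.toReal_mono (ENNReal.mul_ne_top ENNReal.ofReal_ne_top hfin3) hsum
    _ = c * (μ (⋃ h, Y h)).toReal := by rw [ENNReal.toReal_mul, ENNReal.toReal_ofReal hc]

/-! ## The exponential supermartingale over the level sets of `(nfail, ndesig)` -/

section Supermartingale

variable {U₀ : Set (Sym2 V)} {A₀ : Set (BondConfig V)}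
  (succ : ProbeHistory V → Finset (Sym2 V) → Prop) (desig : ProbeHistory V → Prop)

/-- The joint level sets of the number of designated failures and the number of designated probes
at time `n`. [folklore] -/
def levelSet₂ (n v w : ℕ) : Set (BondConfig V) :=
  {ω | nfail succ desig (E.hist n ω) = v ∧ ndesig desig (E.hist n ω) = w}

omit [Countable V] in
/-- Membership in a joint level set. [folklore] -/
theorem mem_levelSet₂ {n v w : ℕ} {ω : BondConfig V} :
    ω ∈ E.levelSet₂ succ desig n v w ↔ nfail succ desig (E.hist n ω) = v ∧ ndesig desig (E.hist n ω) = w :=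
  Iff.rfl

/-- The joint level sets are measurable. [folklore] -/
theorem measurableSet_levelSet₂ (n v w : ℕ) : MeasurableSet (E.levelSet₂ succ desig n v w) :=
  E.measurableSet_setOf_hist' n fun h => nfail succ desig h = v ∧ ndesig desig h = w

omit [Countable V] in
/-- At time `0` only the level `(0, 0)` is inhabited, by everything. [folklore] -/
theorem levelSet₂_zero (v w : ℕ) :
    E.levelSet₂ succ desig 0 v w = (if v = 0 ∧ w = 0 then Set.univ else ∅) := by
  ext ω
  simp only [mem_levelSet₂, hist_zero, nfail_nil, ndesig_nil]
  split_ifs with h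
  · simp only [Set.mem_univ, iff_true]; exact ⟨h.1.symm, h.2.symm⟩
  · simp only [Set.mem_empty_iff_false, iff_false, not_and]
    intro hv hw; exact h ⟨hv.symm, hw.symm⟩

/-- **The exponential supermartingale.** If after every designated history the next probe
satisfies `P(succ) + φ·P(¬succ) ≤ c` (`φ ≥ 0`, `c > 0`), then for all `N, n`:
`Σ_{v<N} Σ_{w<N} φ^v c^{-w} P(A₀ ∩ {nfail = v, ndesig = w at time n}) ≤ P(A₀)` — the potential
`φ^{nfail} c^{-ndesig}` is a supermartingale along the exploration.
[cite: KozmaNachmias2011, §4.4 (Lemmas 4.5–4.6: the martingales `γ_i`, `β_i`; here in exponential-moment form)] -/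
theorem sum_weight_mul_measureReal_levelSet₂_le (hE : E.Fresh U₀) (hA : DeterminedBy A₀ U₀)
    (hAm : MeasurableSet A₀) {φ c : ℝ} (hφ : 0 ≤ φ) (hc : 0 < c)
    (hstep : ∀ h D, E.next h = some D → desig h →
      (bondPercolation G p).real {ω | succ h (obs ω D)} +
        φ * (bondPercolation G p).real {ω | ¬succ h (obs ω D)} ≤ c)
    (N n : ℕ) :
    ∑ v ∈ range N, ∑ w ∈ range N,
        φ ^ v * c⁻¹ ^ w * (bondPercolation G p).real (A₀ ∩ E.levelSet₂ succ desig n v w) ≤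
      (bondPercolation G p).real A₀ := by
  set μ := bondPercolation G p with hμ
  have hci : 0 ≤ c⁻¹ := inv_nonneg.2 hc.le
  have ha : ∀ v w, 0 ≤ φ ^ v * c⁻¹ ^ w := fun v w => mul_nonneg (pow_nonneg hφ v) (pow_nonneg hci w)
  induction n with
  | zero =>
    -- only `(0,0)` contributes
    have hterm : ∀ v ∈ range N, ∀ w ∈ range N,
        φ ^ v * c⁻¹ ^ w * μ.real (A₀ ∩ E.levelSet₂ succ desig 0 v w) =
          if v = 0 ∧ w = 0 then μ.real A₀ else 0 := by
      intro v _ w _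
      rw [levelSet₂_zero]
      split_ifs with h
      · rw [h.1, h.2, pow_zero, pow_zero, one_mul, one_mul, Set.inter_univ]
      · rw [Set.inter_empty, measureReal_empty, mul_zero]
    rw [Finset.sum_congr rfl fun v hv => Finset.sum_congr rfl fun w hw => hterm v hv w hw]
    rcases Nat.eq_zero_or_pos N with hN | hN
    · subst hN; simp [measureReal_nonneg]
    · rw [Finset.sum_eq_single_of_mem 0 (Finset.mem_range.2 hN)
        (fun v _ hv => Finset.sum_eq_zero fun w _ => by rw [if_neg (fun h => hv h.1)])]
      rw [Finset.sum_eq_single_of_mem 0 (Finset.mem_range.2 hN)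
        (fun w _ hw => by rw [if_neg (fun h => hw h.2)])]
      simp
  | succ n ih =>
    -- the pieces of `A₀ ∩ levelSet₂ n v w`
    set U : ℕ → ℕ → Set (BondConfig V) := fun v w => A₀ ∩ {ω |
        (nfail succ desig (E.hist n ω) = v ∧ ndesig desig (E.hist n ω) = w) ∧
          (E.next (E.hist n ω) = none ∨ ¬desig (E.hist n ω))} with hU
    set Gd : ℕ → ℕ → Set (BondConfig V) := fun v w => A₀ ∩ {ω |
        ((nfail succ desig (E.hist n ω) = v ∧ ndesig desig (E.hist n ω) = w) ∧ desig (E.hist n ω)) ∧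
          E.next (E.hist n ω) ≠ none} with hGd
    set Fs : ℕ → ℕ → Set (BondConfig V) := fun v w => A₀ ∩ {ω |
        ((nfail succ desig (E.hist n ω) = v ∧ ndesig desig (E.hist n ω) = w) ∧ desig (E.hist n ω)) ∧
          ∃ D, E.next (E.hist n ω) = some D ∧ succ (E.hist n ω) (obs ω D)} with hFs
    set Ff : ℕ → ℕ → Set (BondConfig V) := fun v w => A₀ ∩ {ω |
        ((nfail succ desig (E.hist n ω) = v ∧ ndesig desig (E.hist n ω) = w) ∧ desig (E.hist n ω)) ∧
          ∃ D, E.next (E.hist n ω) = some D ∧ ¬succ (E.hist n ω) (obs ω D)} with hFf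
    have hGm : ∀ v w, MeasurableSet (Gd v w) := fun v w => hAm.inter (E.measurableSet_setOf_hist' n fun h =>
      ((nfail succ desig h = v ∧ ndesig desig h = w) ∧ desig h) ∧ E.next h ≠ none)
    -- partition at time `n`
    have hUG : ∀ v w, μ.real (U v w) + μ.real (Gd v w) = μ.real (A₀ ∩ E.levelSet₂ succ desig n v w) := by
      intro v w
      have hdisj : Disjoint (U v w) (Gd v w) := Set.disjoint_left.2 fun ω hU' hG' => by
        rcases hU'.2.2 with h1 | h1
        · exact hG'.2.2 h1
        · exact h1 hG'.2.1.2
      have hunion : U v w ∪ Gd v w = A₀ ∩ E.levelSet₂ succ desig n v w := by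
        ext ω
        simp only [hU, hGd, levelSet₂, Set.mem_union, Set.mem_inter_iff, Set.mem_setOf_eq]
        constructor
        · rintro (⟨hA', hl, -⟩ | ⟨hA', ⟨hl, -⟩, -⟩) <;> exact ⟨hA', hl⟩
        · rintro ⟨hA', hl⟩
          by_cases hd : E.next (E.hist n ω) = none ∨ ¬desig (E.hist n ω)
          · exact Or.inl ⟨hA', hl, hd⟩
          · push Not at hd
            exact Or.inr ⟨hA', ⟨hl, hd.2⟩, hd.1⟩
      rw [← hunion, measureReal_union hdisj (hGm v w)]
    -- the linear conditional step
    have hF : ∀ v w, μ.real (Fs v w) + φ * μ.real (Ff v w) ≤ c * μ.real (Gd v w) := fun v w =>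
      E.measureReal_step_linear_le G p hE hA hAm n
        (fun h => (nfail succ desig h = v ∧ ndesig desig h = w) ∧ desig h) succ hφ hc.le
        fun h D hD hΦ => hstep h D hD hΦ.2
    -- the level sets at time `n + 1`
    have hstep' : ∀ v w, μ.real (A₀ ∩ E.levelSet₂ succ desig (n + 1) v w) ≤
        μ.real (U v w) + ((if w = 0 then 0 else μ.real (Fs v (w - 1))) +
          (if v = 0 ∨ w = 0 then 0 else μ.real (Ff (v - 1) (w - 1)))) := by
      intro v w
      have hsub : A₀ ∩ E.levelSet₂ succ desig (n + 1) v w ⊆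
          U v w ∪ ((if w = 0 then ∅ else Fs v (w - 1)) ∪ (if v = 0 ∨ w = 0 then ∅ else Ff (v - 1) (w - 1))) := by
        rintro ω ⟨hA', hω⟩
        simp only [levelSet₂, Set.mem_setOf_eq, hist_succ] at hω
        rcases Option.eq_none_or_eq_some (E.next (E.hist n ω)) with hD | ⟨D, hD⟩
        · rw [E.step_of_none hD, nfail_cons_none, ndesig_cons_none] at hω
          exact Or.inl ⟨hA', hω, Or.inl hD⟩
        · rw [E.step_of_some hD, nfail_cons_some, ndesig_cons_some] at hω
          obtain ⟨hnh, hnd⟩ := hω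
          by_cases hd : desig (E.hist n ω)
          · rw [if_pos hd] at hnd
            have hw : w ≠ 0 := by omega
            refine Or.inr ?_
            by_cases hp : succ (E.hist n ω) (obs ω D)
            · rw [if_neg (fun h' => h'.2 hp)] at hnh
              refine Or.inl ?_
              rw [if_neg hw]
              exact ⟨hA', ⟨⟨⟨by omega, by omega⟩, hd⟩, D, hD, hp⟩⟩
            · rw [if_pos ⟨hd, hp⟩] at hnh
              have hv : v ≠ 0 := by omega
              refine Or.inr ?_
              rw [if_neg (not_or.2 ⟨hv, hw⟩)]
              exact ⟨hA', ⟨⟨⟨by omega, by omega⟩, hd⟩, D, hD, hp⟩⟩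
          · rw [if_neg hd] at hnd
            rw [if_neg (fun h' => hd h'.1)] at hnh
            exact Or.inl ⟨hA', ⟨by omega, by omega⟩, Or.inr hd⟩
      refine (measureReal_mono hsub).trans ((measureReal_union_le _ _).trans
        (add_le_add le_rfl ((measureReal_union_le _ _).trans (add_le_add ?_ ?_))))
      · split_ifs <;> simp
      · split_ifs <;> simp
    -- the computation
    have hsumU : ∀ v, ∑ w ∈ range N, φ ^ v * c⁻¹ ^ w * (if w = 0 then 0 else μ.real (Fs v (w - 1))) ≤
        ∑ w ∈ range N, φ ^ v * c⁻¹ ^ (w + 1) * μ.real (Fs v w) := by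
      intro v
      cases N with
      | zero => simp
      | succ M =>
        rw [Finset.sum_range_succ' (fun w => φ ^ v * c⁻¹ ^ w * (if w = 0 then 0 else μ.real (Fs v (w - 1))))]
        simp only [Nat.add_one_ne_zero, ↓reduceIte, Nat.add_sub_cancel, mul_zero, add_zero]
        rw [Finset.sum_range_succ]
        exact le_add_of_nonneg_right (mul_nonneg (ha v (M + 1)) measureReal_nonneg)
    have hsumV : ∑ v ∈ range N, ∑ w ∈ range N,
          φ ^ v * c⁻¹ ^ w * (if v = 0 ∨ w = 0 then 0 else μ.real (Ff (v - 1) (w - 1))) ≤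
        ∑ v ∈ range N, ∑ w ∈ range N, φ ^ (v + 1) * c⁻¹ ^ (w + 1) * μ.real (Ff v w) := by
      cases N with
      | zero => simp
      | succ M =>
        rw [Finset.sum_range_succ' (fun v => ∑ w ∈ range (M + 1),
          φ ^ v * c⁻¹ ^ w * (if v = 0 ∨ w = 0 then 0 else μ.real (Ff (v - 1) (w - 1))))]
        simp only [true_or, ↓reduceIte, mul_zero, Finset.sum_const_zero, add_zero, Nat.add_one_ne_zero,
          false_or, Nat.add_sub_cancel]
        calc ∑ v ∈ range M, ∑ w ∈ range (M + 1),
              φ ^ (v + 1) * c⁻¹ ^ w * (if w = 0 then 0 else μ.real (Ff v (w - 1)))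
            ≤ ∑ v ∈ range M, ∑ w ∈ range (M + 1), φ ^ (v + 1) * c⁻¹ ^ (w + 1) * μ.real (Ff v w) := by
              refine Finset.sum_le_sum fun v _ => ?_
              rw [Finset.sum_range_succ' (fun w => φ ^ (v + 1) * c⁻¹ ^ w *
                (if w = 0 then 0 else μ.real (Ff v (w - 1))))]
              simp only [Nat.add_one_ne_zero, ↓reduceIte, Nat.add_sub_cancel, mul_zero, add_zero]
              rw [Finset.sum_range_succ]
              exact le_add_of_nonneg_right (mul_nonneg (ha (v + 1) (M + 1)) measureReal_nonneg)
          _ ≤ ∑ v ∈ range (M + 1), ∑ w ∈ range (M + 1), φ ^ (v + 1) * c⁻¹ ^ (w + 1) * μ.real (Ff v w) := by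
              rw [Finset.sum_range_succ (fun v => ∑ w ∈ range (M + 1),
                φ ^ (v + 1) * c⁻¹ ^ (w + 1) * μ.real (Ff v w))]
              exact le_add_of_nonneg_right (Finset.sum_nonneg fun w _ =>
                mul_nonneg (ha (M + 1) (w + 1)) measureReal_nonneg)
    calc ∑ v ∈ range N, ∑ w ∈ range N, φ ^ v * c⁻¹ ^ w * μ.real (A₀ ∩ E.levelSet₂ succ desig (n + 1) v w)
        ≤ ∑ v ∈ range N, ∑ w ∈ range N, φ ^ v * c⁻¹ ^ w * (μ.real (U v w) +
            ((if w = 0 then 0 else μ.real (Fs v (w - 1))) +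
              (if v = 0 ∨ w = 0 then 0 else μ.real (Ff (v - 1) (w - 1))))) :=
          Finset.sum_le_sum fun v _ => Finset.sum_le_sum fun w _ =>
            mul_le_mul_of_nonneg_left (hstep' v w) (ha v w)
      _ = ∑ v ∈ range N, ∑ w ∈ range N, φ ^ v * c⁻¹ ^ w * μ.real (U v w) +
          (∑ v ∈ range N, ∑ w ∈ range N, φ ^ v * c⁻¹ ^ w * (if w = 0 then 0 else μ.real (Fs v (w - 1))) +
            ∑ v ∈ range N, ∑ w ∈ range N,
              φ ^ v * c⁻¹ ^ w * (if v = 0 ∨ w = 0 then 0 else μ.real (Ff (v - 1) (w - 1)))) := by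
          rw [← Finset.sum_add_distrib, ← Finset.sum_add_distrib]
          refine Finset.sum_congr rfl fun v _ => ?_
          rw [← Finset.sum_add_distrib, ← Finset.sum_add_distrib]
          refine Finset.sum_congr rfl fun w _ => by ring
      _ ≤ ∑ v ∈ range N, ∑ w ∈ range N, φ ^ v * c⁻¹ ^ w * μ.real (U v w) +
          (∑ v ∈ range N, ∑ w ∈ range N, φ ^ v * c⁻¹ ^ (w + 1) * μ.real (Fs v w) +
            ∑ v ∈ range N, ∑ w ∈ range N, φ ^ (v + 1) * c⁻¹ ^ (w + 1) * μ.real (Ff v w)) :=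
          add_le_add le_rfl (add_le_add (Finset.sum_le_sum fun v _ => hsumU v) hsumV)
      _ = ∑ v ∈ range N, ∑ w ∈ range N, φ ^ v * c⁻¹ ^ w *
            (μ.real (U v w) + c⁻¹ * (μ.real (Fs v w) + φ * μ.real (Ff v w))) := by
          rw [← Finset.sum_add_distrib, ← Finset.sum_add_distrib]
          refine Finset.sum_congr rfl fun v _ => ?_
          rw [← Finset.sum_add_distrib, ← Finset.sum_add_distrib]
          refine Finset.sum_congr rfl fun w _ => by ring
      _ ≤ ∑ v ∈ range N, ∑ w ∈ range N, φ ^ v * c⁻¹ ^ w * (μ.real (U v w) + c⁻¹ * (c * μ.real (Gd v w))) :=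
          Finset.sum_le_sum fun v _ => Finset.sum_le_sum fun w _ =>
            mul_le_mul_of_nonneg_left (add_le_add le_rfl (mul_le_mul_of_nonneg_left (hF v w) hci)) (ha v w)
      _ = ∑ v ∈ range N, ∑ w ∈ range N, φ ^ v * c⁻¹ ^ w * μ.real (A₀ ∩ E.levelSet₂ succ desig n v w) := by
          refine Finset.sum_congr rfl fun v _ => Finset.sum_congr rfl fun w _ => ?_
          rw [← hUG v w, ← mul_assoc, inv_mul_cancel₀ hc.ne', one_mul]
      _ ≤ μ.real A₀ := ih

/-! ## The two Chernoff bounds -/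

/-- **Upper tail of the designated failures** (Kozma–Nachmias 2011, Lemma 4.6, abstract form).
If every designated probe fails with probability at most `ρ`, then for every `t ≥ 0`, real `a`
and `i`: `P(A₀ ∩ {a ≤ nfail, ndesig ≤ i at time n}) ≤ e^{-ta} (1 + ρ(e^t - 1))^i P(A₀)`.
[cite: KozmaNachmias2011, Lemma 4.6 (via Azuma–Hoeffding for `β_i`; here the exponential-moment bound)] -/
theorem measureReal_inter_le_of_failProb_le (hE : E.Fresh U₀) (hA : DeterminedBy A₀ U₀)
    (hAm : MeasurableSet A₀) {ρ : ℝ} (hρ0 : 0 ≤ ρ)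
    (hρ : ∀ h D, E.next h = some D → desig h → (bondPercolation G p).real {ω | ¬succ h (obs ω D)} ≤ ρ)
    {t : ℝ} (ht : 0 ≤ t) (n i : ℕ) (a : ℝ) :
    (bondPercolation G p).real
        (A₀ ∩ {ω | a ≤ nfail succ desig (E.hist n ω) ∧ ndesig desig (E.hist n ω) ≤ i}) ≤
      Real.exp (-(t * a)) * (1 + ρ * (Real.exp t - 1)) ^ i * (bondPercolation G p).real A₀ := by
  set μ := bondPercolation G p with hμ
  set φ : ℝ := Real.exp t with hφ
  set c : ℝ := 1 + ρ * (Real.exp t - 1) with hc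
  have hφ1 : 1 ≤ φ := Real.one_le_exp ht
  have hφ0 : 0 ≤ φ := zero_le_one.trans hφ1
  have hc1 : 1 ≤ c := le_add_of_nonneg_right (mul_nonneg hρ0 (by linarith))
  have hc0 : 0 < c := zero_lt_one.trans_le hc1
  have hci1 : c⁻¹ ≤ 1 := inv_le_one_of_one_le₀ hc1
  have hci0 : 0 ≤ c⁻¹ := inv_nonneg.2 hc0.le
  -- the step hypothesis
  have hstep : ∀ h D, E.next h = some D → desig h →
      μ.real {ω | succ h (obs ω D)} + φ * μ.real {ω | ¬succ h (obs ω D)} ≤ c := by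
    intro h D hD hd
    have hcompl : μ.real {ω | succ h (obs ω D)} = 1 - μ.real {ω | ¬succ h (obs ω D)} := by
      have : {ω : BondConfig V | succ h (obs ω D)} = {ω | ¬succ h (obs ω D)}ᶜ := by
        ext ω; simp
      rw [this, measureReal_compl (measurableSet_setOf_obs D (fun o => ¬succ h o)), probReal_univ]
    rw [hcompl]
    have := hρ h D hD hd
    nlinarith [measureReal_nonneg (μ := μ) (s := {ω | ¬succ h (obs ω D)})]
  have hS := E.sum_weight_mul_measureReal_levelSet₂_le G p succ desig hE hA hAm hφ0 hc0 hstep (n + 1) n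
  -- Markov on the level sets
  set T := (range (n + 1) ×ˢ range (n + 1)).filter (fun vw : ℕ × ℕ => a ≤ vw.1 ∧ vw.2 ≤ i) with hT
  have hsub : A₀ ∩ {ω | a ≤ nfail succ desig (E.hist n ω) ∧ ndesig desig (E.hist n ω) ≤ i} ⊆
      ⋃ vw ∈ T, A₀ ∩ E.levelSet₂ succ desig n vw.1 vw.2 := by
    rintro ω ⟨hA', ha, hi⟩
    simp only [hT, Set.mem_iUnion, Finset.mem_filter, Finset.mem_product, Finset.mem_range, exists_prop]
    refine ⟨(nfail succ desig (E.hist n ω), ndesig desig (E.hist n ω)), ⟨⟨?_, ?_⟩, ha, hi⟩, hA', rfl, rfl⟩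
    · have := nfail_le_length (succ := succ) (desig := desig) (E.hist n ω)
      rw [length_hist] at this; omega
    · have := ndesig_le_length (desig := desig) (E.hist n ω)
      rw [length_hist] at this; omega
  have hK : 0 ≤ Real.exp (-(t * a)) * c ^ i := mul_nonneg (Real.exp_nonneg _) (pow_nonneg hc0.le i)
  have hweight : ∀ vw ∈ T, μ.real (A₀ ∩ E.levelSet₂ succ desig n vw.1 vw.2) ≤
      Real.exp (-(t * a)) * c ^ i * (φ ^ vw.1 * c⁻¹ ^ vw.2 * μ.real (A₀ ∩ E.levelSet₂ succ desig n vw.1 vw.2)) := by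
    rintro ⟨v, w⟩ hvw
    obtain ⟨-, hav, hwi⟩ := Finset.mem_filter.1 hvw
    have h1 : 1 ≤ Real.exp (-(t * a)) * c ^ i * (φ ^ v * c⁻¹ ^ w) := by
      have hφv : Real.exp (t * a) ≤ φ ^ v := by
        rw [hφ, ← Real.exp_nat_mul]
        exact Real.exp_le_exp.2 (by nlinarith)
      have hcw : c⁻¹ ^ i ≤ c⁻¹ ^ w := pow_le_pow_of_le_one hci0 hci1 hwi
      have hea : 0 < Real.exp (t * a) := Real.exp_pos _
      calc (1 : ℝ) = (Real.exp (-(t * a)) * Real.exp (t * a)) * (c ^ i * c⁻¹ ^ i) := by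
            rw [← Real.exp_add, neg_add_cancel, Real.exp_zero, ← mul_pow, mul_inv_cancel₀ hc0.ne', one_pow,
              one_mul]
        _ = Real.exp (-(t * a)) * c ^ i * (Real.exp (t * a) * c⁻¹ ^ i) := by ring
        _ ≤ Real.exp (-(t * a)) * c ^ i * (φ ^ v * c⁻¹ ^ w) :=
            mul_le_mul_of_nonneg_left (mul_le_mul hφv hcw (pow_nonneg hci0 i) (pow_nonneg hφ0 v)) hK
    calc μ.real (A₀ ∩ E.levelSet₂ succ desig n v w) = 1 * μ.real (A₀ ∩ E.levelSet₂ succ desig n v w) :=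
          (one_mul _).symm
      _ ≤ (Real.exp (-(t * a)) * c ^ i * (φ ^ v * c⁻¹ ^ w)) * μ.real (A₀ ∩ E.levelSet₂ succ desig n v w) :=
          mul_le_mul_of_nonneg_right h1 measureReal_nonneg
      _ = _ := by ring
  calc μ.real (A₀ ∩ {ω | a ≤ nfail succ desig (E.hist n ω) ∧ ndesig desig (E.hist n ω) ≤ i})
      ≤ μ.real (⋃ vw ∈ T, A₀ ∩ E.levelSet₂ succ desig n vw.1 vw.2) := measureReal_mono hsub (measure_ne_top _ _)
    _ ≤ ∑ vw ∈ T, μ.real (A₀ ∩ E.levelSet₂ succ desig n vw.1 vw.2) := measureReal_biUnion_finset_le _ _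
    _ ≤ ∑ vw ∈ T, Real.exp (-(t * a)) * c ^ i *
          (φ ^ vw.1 * c⁻¹ ^ vw.2 * μ.real (A₀ ∩ E.levelSet₂ succ desig n vw.1 vw.2)) :=
        Finset.sum_le_sum hweight
    _ = Real.exp (-(t * a)) * c ^ i *
          ∑ vw ∈ T, φ ^ vw.1 * c⁻¹ ^ vw.2 * μ.real (A₀ ∩ E.levelSet₂ succ desig n vw.1 vw.2) := by
        rw [Finset.mul_sum]
    _ ≤ Real.exp (-(t * a)) * c ^ i * ∑ vw ∈ range (n + 1) ×ˢ range (n + 1),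
          φ ^ vw.1 * c⁻¹ ^ vw.2 * μ.real (A₀ ∩ E.levelSet₂ succ desig n vw.1 vw.2) := by
        refine mul_le_mul_of_nonneg_left (Finset.sum_le_sum_of_subset_of_nonneg (Finset.filter_subset _ _)
          fun vw _ _ => mul_nonneg (mul_nonneg (pow_nonneg hφ0 _) (pow_nonneg hci0 _)) measureReal_nonneg) hK
    _ = Real.exp (-(t * a)) * c ^ i * ∑ v ∈ range (n + 1), ∑ w ∈ range (n + 1),
          φ ^ v * c⁻¹ ^ w * μ.real (A₀ ∩ E.levelSet₂ succ desig n v w) := by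
        rw [Finset.sum_product]
    _ ≤ Real.exp (-(t * a)) * c ^ i * μ.real A₀ := mul_le_mul_of_nonneg_left hS hK

/-- **Lower tail of the designated failures** (Kozma–Nachmias 2011, Lemma 4.5, abstract form).
If every designated probe fails with probability at least `μ₀ ∈ [0, 1]`, then for every `t ≥ 0`,
real `a` and `i`: `P(A₀ ∩ {nfail ≤ a, i ≤ ndesig at time n}) ≤ e^{ta} (1 - μ₀(1 - e^{-t}))^i P(A₀)`.
[cite: KozmaNachmias2011, Lemma 4.5 (via Azuma–Hoeffding for `γ_i`; here the exponential-moment bound)] -/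
theorem measureReal_inter_le_of_le_failProb (hE : E.Fresh U₀) (hA : DeterminedBy A₀ U₀)
    (hAm : MeasurableSet A₀) {μ₀ : ℝ} (hμ0 : 0 ≤ μ₀) (hμ1 : μ₀ ≤ 1)
    (hμ : ∀ h D, E.next h = some D → desig h → μ₀ ≤ (bondPercolation G p).real {ω | ¬succ h (obs ω D)})
    {t : ℝ} (ht : 0 ≤ t) (n i : ℕ) (a : ℝ) :
    (bondPercolation G p).real
        (A₀ ∩ {ω | (nfail succ desig (E.hist n ω) : ℝ) ≤ a ∧ i ≤ ndesig desig (E.hist n ω)}) ≤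
      Real.exp (t * a) * (1 - μ₀ * (1 - Real.exp (-t))) ^ i * (bondPercolation G p).real A₀ := by
  set μ := bondPercolation G p with hμ'
  set φ : ℝ := Real.exp (-t) with hφ
  set c : ℝ := 1 - μ₀ * (1 - Real.exp (-t)) with hc
  have hφ0 : 0 < φ := Real.exp_pos _
  have hφ1 : φ ≤ 1 := Real.exp_le_one_iff.2 (by linarith)
  have hcφ : φ ≤ c := by
    rw [hc]; nlinarith
  have hc0 : 0 < c := hφ0.trans_le hcφ
  have hc1 : c ≤ 1 := by rw [hc]; nlinarith
  have hci1 : 1 ≤ c⁻¹ := (one_le_inv₀ hc0).2 hc1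
  have hci0 : 0 ≤ c⁻¹ := inv_nonneg.2 hc0.le
  -- the step hypothesis
  have hstep : ∀ h D, E.next h = some D → desig h →
      μ.real {ω | succ h (obs ω D)} + φ * μ.real {ω | ¬succ h (obs ω D)} ≤ c := by
    intro h D hD hd
    have hcompl : μ.real {ω | succ h (obs ω D)} = 1 - μ.real {ω | ¬succ h (obs ω D)} := by
      have : {ω : BondConfig V | succ h (obs ω D)} = {ω | ¬succ h (obs ω D)}ᶜ := by
        ext ω; simp
      rw [this, measureReal_compl (measurableSet_setOf_obs D (fun o => ¬succ h o)), probReal_univ]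
    rw [hcompl]
    have := hμ h D hD hd
    nlinarith [measureReal_nonneg (μ := μ) (s := {ω | ¬succ h (obs ω D)})]
  have hS := E.sum_weight_mul_measureReal_levelSet₂_le G p succ desig hE hA hAm hφ0.le hc0 hstep (n + 1) n
  -- Markov on the level sets
  set T := (range (n + 1) ×ˢ range (n + 1)).filter (fun vw : ℕ × ℕ => (vw.1 : ℝ) ≤ a ∧ i ≤ vw.2) with hT
  have hsub : A₀ ∩ {ω | (nfail succ desig (E.hist n ω) : ℝ) ≤ a ∧ i ≤ ndesig desig (E.hist n ω)} ⊆
      ⋃ vw ∈ T, A₀ ∩ E.levelSet₂ succ desig n vw.1 vw.2 := by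
    rintro ω ⟨hA', ha, hi⟩
    simp only [hT, Set.mem_iUnion, Finset.mem_filter, Finset.mem_product, Finset.mem_range, exists_prop]
    refine ⟨(nfail succ desig (E.hist n ω), ndesig desig (E.hist n ω)), ⟨⟨?_, ?_⟩, ha, hi⟩, hA', rfl, rfl⟩
    · have := nfail_le_length (succ := succ) (desig := desig) (E.hist n ω)
      rw [length_hist] at this; omega
    · have := ndesig_le_length (desig := desig) (E.hist n ω)
      rw [length_hist] at this; omega
  have hK : 0 ≤ Real.exp (t * a) * c ^ i := mul_nonneg (Real.exp_nonneg _) (pow_nonneg hc0.le i)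
  have hweight : ∀ vw ∈ T, μ.real (A₀ ∩ E.levelSet₂ succ desig n vw.1 vw.2) ≤
      Real.exp (t * a) * c ^ i * (φ ^ vw.1 * c⁻¹ ^ vw.2 * μ.real (A₀ ∩ E.levelSet₂ succ desig n vw.1 vw.2)) := by
    rintro ⟨v, w⟩ hvw
    obtain ⟨-, hav, hwi⟩ := Finset.mem_filter.1 hvw
    have h1 : 1 ≤ Real.exp (t * a) * c ^ i * (φ ^ v * c⁻¹ ^ w) := by
      have hφv : Real.exp (-(t * a)) ≤ φ ^ v := by
        rw [hφ, ← Real.exp_nat_mul]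
        exact Real.exp_le_exp.2 (by nlinarith)
      have hcw : c⁻¹ ^ i ≤ c⁻¹ ^ w := pow_le_pow_right₀ hci1 hwi
      calc (1 : ℝ) = (Real.exp (t * a) * Real.exp (-(t * a))) * (c ^ i * c⁻¹ ^ i) := by
            rw [← Real.exp_add, add_neg_cancel, Real.exp_zero, ← mul_pow, mul_inv_cancel₀ hc0.ne', one_pow,
              one_mul]
        _ = Real.exp (t * a) * c ^ i * (Real.exp (-(t * a)) * c⁻¹ ^ i) := by ring
        _ ≤ Real.exp (t * a) * c ^ i * (φ ^ v * c⁻¹ ^ w) :=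
            mul_le_mul_of_nonneg_left (mul_le_mul hφv hcw (pow_nonneg hci0 i) (pow_nonneg hφ0.le v)) hK
    calc μ.real (A₀ ∩ E.levelSet₂ succ desig n v w) = 1 * μ.real (A₀ ∩ E.levelSet₂ succ desig n v w) :=
          (one_mul _).symm
      _ ≤ (Real.exp (t * a) * c ^ i * (φ ^ v * c⁻¹ ^ w)) * μ.real (A₀ ∩ E.levelSet₂ succ desig n v w) :=
          mul_le_mul_of_nonneg_right h1 measureReal_nonneg
      _ = _ := by ring
  calc μ.real (A₀ ∩ {ω | (nfail succ desig (E.hist n ω) : ℝ) ≤ a ∧ i ≤ ndesig desig (E.hist n ω)})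
      ≤ μ.real (⋃ vw ∈ T, A₀ ∩ E.levelSet₂ succ desig n vw.1 vw.2) := measureReal_mono hsub (measure_ne_top _ _)
    _ ≤ ∑ vw ∈ T, μ.real (A₀ ∩ E.levelSet₂ succ desig n vw.1 vw.2) := measureReal_biUnion_finset_le _ _
    _ ≤ ∑ vw ∈ T, Real.exp (t * a) * c ^ i *
          (φ ^ vw.1 * c⁻¹ ^ vw.2 * μ.real (A₀ ∩ E.levelSet₂ succ desig n vw.1 vw.2)) :=
        Finset.sum_le_sum hweight
    _ = Real.exp (t * a) * c ^ i *
          ∑ vw ∈ T, φ ^ vw.1 * c⁻¹ ^ vw.2 * μ.real (A₀ ∩ E.levelSet₂ succ desig n vw.1 vw.2) := by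
        rw [Finset.mul_sum]
    _ ≤ Real.exp (t * a) * c ^ i * ∑ vw ∈ range (n + 1) ×ˢ range (n + 1),
          φ ^ vw.1 * c⁻¹ ^ vw.2 * μ.real (A₀ ∩ E.levelSet₂ succ desig n vw.1 vw.2) := by
        refine mul_le_mul_of_nonneg_left (Finset.sum_le_sum_of_subset_of_nonneg (Finset.filter_subset _ _)
          fun vw _ _ => mul_nonneg (mul_nonneg (pow_nonneg hφ0.le _) (pow_nonneg hci0 _)) measureReal_nonneg) hK
    _ = Real.exp (t * a) * c ^ i * ∑ v ∈ range (n + 1), ∑ w ∈ range (n + 1),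
          φ ^ v * c⁻¹ ^ w * μ.real (A₀ ∩ E.levelSet₂ succ desig n v w) := by
        rw [Finset.sum_product]
    _ ≤ Real.exp (t * a) * c ^ i * μ.real A₀ := mul_le_mul_of_nonneg_left hS hK

end Supermartingale

end Explorer

end Literature.Probability.Percolation
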